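import Literature.MathematicalPhysics.QuantumFieldTheory.Balaban1983to89.B16Ineq382TreeGauge

/-!
# `Balaban1983to89.B16Ineq382VPrime` — T. Bałaban, *Large field renormalization. II. Localization, exponentiation, and bounds for the 𝐑 operation*, Commun. Math. Phys. **122** (1989) 355–392 [Balaban1989LargeFieldII], pp. 381–382, case 1 of the factor `1 − χ′`: the chain from `|V₁(b) − 1|` back to the fluctuation field, *"The gauge transformation v is determined by V₀ only, because V′ satisfies the conditions … hence |v(x) − 1| = |V₀(Γ_{y,x}) − 1| < (d + 1)100MR_{j−N+1}·[…] … From the above estimates we obtain |V′(b) − 1| < …"* — PROVED at object level over the gauge of [Balaban1989LargeFieldI] p. 196 (PART 3 of the case-1 estimate; PARTS 1–2 = `B16Ineq382Stokes`, `B16Ineq382Cases`, `B16Ineq382TreeGauge`; the row's typed arithmetic shape `B16Sect1Statements.Ineq382V'` is DISCHARGED BY NAME under an explicit dictionary)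

statement-level skeleton of published theorems with citation tags; proofs where landed; nothing here is a claim about the Yang–Mills mass gap

PDF held: `paper:balaban1989-cmp122-large-field-ii` (journal page = PDF page + 354; pp. 381–382 = PDF pp. 27–28,
re-read AS IMAGES for this file: `run/shared/lean/pub/pub-balaban/b2b-balaban-ref1/pages/1989-cmp122-large-field-II/
…-p027-x2.png`, `…-p028-x2.png`); `paper:balaban1989-cmp122-large-field-i` = [IV] (pp. 195–196 = PDF pp. 21–22,
renders `…1989-cmp122-large-field-I-p021-x2.png`, `…-p022-x2.png`: (1.81) `V″ = V′V₀` and the tree gauge).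

WHAT IS REPRODUCED (mega-formalization `lit-balaban`, HOME `run/shared/lean/pub/lit-balaban/`, Phase-2 seat p26,
generation 3; SKELETON row **B16.Lem@381** (r13; the `V′(b)` display typed p240851 as the arithmetic shape
`B16Sect1Statements.Ineq382V'` with the deviation `dev` abstract), referee ref-5).  [IV] p. 195, (1.81): *"V″ = V′V₀
on Λ₀"*; [IV] p. 196: *"The union of all the contours is a tree graph T on P₁∖P₂ … We fix the gauge putting the bond
variables equal to 1 for bonds belonging to the tree graph."*  P. 381 (render p027): *"Assume that the plaquette
variables of V″ on this domain are small, i.e., |V″(∂p′) − 1| < ε for p′ ⊂ Ω″^{~2}_{h+1}∖Ω″_{h+1}, and transform the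
field V″ into a field satisfying the axial gauge conditions. The gauge transformation v is determined by V₀ only,
because V′ satisfies the conditions, and is given by v(x) = V₀(Γ_{y,x}), where the contour Γ_{y,x} was defined in
Sect. 1 [IV]. We obtain the field V₁ = V″^v = v₋V′V₀v₊⁻¹, which satisfies … the axial gauge conditions."*  P. 382
(render p028): *"|V₁(b) − 1| < 6(100MR_{j−N+1})²ε … The estimate holds for b ⊂ Ω″^{~2}_{h+1}∖Ω″_{h+1}, and on this
domain the field V₀ is given by V₀ = exp iQ̃_{j−N}(L^{−j}A₀), where A₀ satisfies (1.87) [IV]. This implies the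
estimate |V₀(b) − 1| ≦ |Q̃_{j−N}(L^{−j}A₀)| < O(1)B₃²B₅M⁶L^{−N}ε_j, hence |v(x) − 1| = |V₀(Γ_{y,x}) − 1| < (d + 1)100M
R_{j−N+1}O(1)B₃²B₅M⁶L^{−N}ε_j < O(1)B₃²B₅M⁷R_jN^{β₀}L^{−N}ε_j. From the above estimates we obtain |V′(b) − 1| <
6(100M(L + 1)R_j^{1+β₀})²ε + O(1)(A₀/A₁)B₃²B₅M⁷R_j^{1+β₀}(p₀(g_j)/p₁(g_j))L^{−N}δ′_j."*

THE TYPING (over the carriers of PARTS 1–2: `Site (n+3) = ℤ^{n+3}`, the annulus `ann lo hi lo' hi'` = `P₁ ∖ P₂` with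
geometry `Geom`, the contours `contour lo hi τ x` = `Γ_{y,x}` of [IV] p. 196, `U1 𝔸`-valued bond fields, the tree's
bondwise product `B8Lemma1NonAbelian.mulCfg V′ V₀` = (1.81) `V″ = V′V₀`).  §6: `BondsOneAlong V p w` — the bond
variables of `V` met along the word `w` from `p` are all `1`; with `w = Γ_{y,x}` for all `x ∈ P₁∖P₂` this is [IV]'s
*"bond variables equal to 1 for bonds belonging to the tree graph"* `T = ⋃ Γ_{y,x}` for the field `V′`; PROVED:
`hol_eq_one_of_bondsOneAlong` (⇒ `V′(Γ_{y,x}) = 1`, the [14]-form used by `Case1Hyp`) and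
**`hol_mulCfg_eq_of_bondsOneAlong`** (`(V′V₀)(Γ) = V₀(Γ)`: *"v is determined by V₀ only, because V′ satisfies the
conditions"*).  §7: `BondSmallOn A V η` (the input `|V₀(b) − 1| ≤ η` on the bonds with ends in `A`) and the
telescoping estimate `norm_hol_sub_one_le_of_pathIn` (`|V(Γ) − 1| ≤ |Γ|·η` for a walk in `A`); `length_contour_le`
(`|Γ_{y,x}| ≤ (d + 1)·W`, `W + 1` = sites per side — the printed factor `(d + 1)100MR_{j−N+1}`).  §8: `FluctHyp` =
the printed situation in the variables `V′, V₀`: `V′` in the tree gauge, `ε`-small plaquettes of `V″ = V′V₀` on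
`P₁∖P₂`, `η`-small bonds of `V₀` on `P₁∖P₂`; PROVED: `FluctHyp.treeGaugeFn_mulCfg` (`V″(Γ_{y,x}) = V₀(Γ_{y,x})`),
`FluctHyp.case1Hyp` (the printed `V₁ = V″^v`, `v(x) = V₀(Γ_{y,x})`, satisfies PART 2's `Case1Hyp`, hence
`FluctHyp.ineq382V₁`: the first display for THIS `V₁`), `FluctHyp.norm_treeGaugeFn_sub_one_le` (`|v(x) − 1| ≤
(d+1)W·η`), `fluct_eq` (`V′(b) = v₋⁻¹V₁(b)v₊V₀(b)⁻¹`), **`FluctHyp.norm_fluct_sub_one_le`**: `‖V′(b) − 1‖ ≤ (5W² +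
dW)ε + (2(d+1)W + 1)η`, the printed strict shape `FluctHyp.norm_fluct_sub_one_lt` (`< 6D²ε + (2(d+1)D + 1)η` for
sides of `≤ D` sites, `d ≤ D`, `0 < ε`), and §9 the DICTIONARY to the typed row: `ineq382V'_of_bound` (pure
arithmetic) and **`FluctHyp.ineq382V'`** = `B16Sect1Statements.Ineq382V' ‖V′(b) − 1‖ M L R_j β₀ ε C A₀ A₁ B₃ B₅ p₀(g_j)
p₁(g_j) L⁻¹ N δ′_j` with `C = 100(2d + 3)(L + 1)K`, under: `D = 100MR′` (condition (i) of [IV] p. 177), `R′ ≤ (L +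
1)R_j^{1+β₀}`, `η ≤ K·B₃²B₅M⁶(L⁻¹)^N ε_j` (the (1.87) [IV] input, `K` = its `O(1)`), `ε_j = (A₀/A₁)(p₀/p₁)δ′_j` ([III]
(2.2)–(2.3): `ε_j = g_jA₀p₀(g_j)`, `δ′_j = g_jA₁p₁(g_j)`).

HONEST SCOPE / DEVIATIONS.  (1) As PARTS 1–2: one rectangular annulus of `ℤ^{n+3}` (`d = n + 3 ≥ 3`), `P₂` strictly
inside `P₁`, `U1 𝔸`-valued fields (`⊇ U(N)`), `≤`-hypotheses.  (2) The analytic input `|V₀(b) − 1| ≦ |Q̃_{j−N}(L^{−j}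
A₀)| < O(1)B₃²B₅M⁶L^{−N}ε_j` ((1.87) [IV] and the averaging bounds) is NOT reproduced: it enters as the hypothesis
`BondSmallOn (P₁∖P₂) V₀ η` / `η ≤ K·B₃²B₅M⁶(L⁻¹)^N ε_j`.  (3) The print's passage `R_{j−N+1} ≦ (L + 1)N^{β₀}R_j`, then
`R_j^{1+β₀}` in the final display ("by our assumptions on N"), is taken as the single hypothesis `R′ ≤ (L + 1)
R_j^{1+β₀}`; the print's `O(1)` of the final display absorbs `(d + 1)·100·(L + 1)` and the `O(1)` of the `V₀` input —
here the explicit `C = 100(2d + 3)(L + 1)K` (the typed shape has `C` free).  (4) The tree gauge of [IV] is typed bond-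
by-bond along the contours (`BondsOneAlong`), i.e. on `T = ⋃_{x ∈ P₁∖P₂} Γ_{y,x}`; the external bonds of `T₀` and the
Faddeev–Popov `δ_{T₀}(V′)` are not typed (as in `B15TreeGauge196`).  Every declaration is a definition with a body or
a proved theorem; nothing of [IV]/[V] is asserted as a hypothesis-free fact.  Unit `lit-balaban-p26`
(literature-prover-lit-balaban-p26-g3-0).
-/

noncomputable section

open scoped BigOperators

namespace Literature.MathematicalPhysics.QuantumFieldTheory.Balaban1983to89.B16Ineq382

open B7Prop1Explicit B8Lemma1NonAbelian B15TreeGauge196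

variable {d : ℕ}

/-! ## §6 [IV] p. 196: the gauge conditions of `V′` — bond variables `1` along the tree contours -/

section TreeBonds

variable {G : Type*} [Group G]

/-- [IV] p. 196: *"We fix the gauge putting the bond variables equal to 1 for bonds belonging to the tree graph"* —
for one contour spelled by the word `w` from `p`: every bond variable of `V` met along `w` equals `1`
(`stepHol V (p + disp w₁) l = 1` for every split `w = w₁ ++ l :: w₂`; for a backward letter this is `V(b)⁻¹ = 1`).
[cite: Balaban1989LargeFieldI, p.196] -/
def BondsOneAlong (V : Site d → Fin d → G) (p : Site d) (w : List (Letter d)) : Prop :=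
  ∀ (w₁ w₂ : List (Letter d)) (l : Letter d), w = w₁ ++ l :: w₂ → stepHol V (p + disp w₁) l = 1

variable {V V' V₀ : Site d → Fin d → G} {p : Site d}

/-- The empty contour carries no condition. [cite: Balaban1989LargeFieldI, p.196] -/
theorem bondsOneAlong_nil : BondsOneAlong V p [] := fun w₁ w₂ l h => by simp at h

/-- One bond, then the rest. [cite: Balaban1989LargeFieldI, p.196] -/
theorem bondsOneAlong_cons {l : Letter d} {w : List (Letter d)} :
    BondsOneAlong V p (l :: w) ↔ stepHol V p l = 1 ∧ BondsOneAlong V (p + l.vec) w := by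
  constructor
  · intro h
    refine ⟨by simpa using h [] w l rfl, fun w₁ w₂ l' hw => ?_⟩
    have := h (l :: w₁) w₂ l' (by rw [hw]; rfl)
    simpa [add_assoc] using this
  · rintro ⟨hl, h⟩ w₁ w₂ l' hw
    cases w₁ with
    | nil =>
      simp only [List.nil_append, List.cons.injEq] at hw
      obtain ⟨rfl, rfl⟩ := hw
      simpa using hl
    | cons l'' w₁ =>
      simp only [List.cons_append, List.cons.injEq] at hw
      obtain ⟨rfl, hw⟩ := hw
      have := h w₁ w₂ l' hw
      simpa [add_assoc] using this

/-- Concatenated contours. [cite: Balaban1989LargeFieldI, p.196] -/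
theorem bondsOneAlong_append {u u' : List (Letter d)} :
    BondsOneAlong V p (u ++ u') ↔ BondsOneAlong V p u ∧ BondsOneAlong V (p + disp u) u' := by
  induction u generalizing p with
  | nil => simp [bondsOneAlong_nil]
  | cons l u ih =>
    rw [List.cons_append, bondsOneAlong_cons, bondsOneAlong_cons, ih, disp_cons, ← add_assoc, and_assoc]

/-- **Tree gauge ⇒ contour conditions**: if the bond variables along `w` are `1` then `V(w) = 1` — [IV]'s gauge
("bond variables equal to 1 for bonds belonging to the tree graph") gives the form `V′(Γ_{y,x}) = 1` used in [14]
p. 79 and in PART 2 (`Case1Hyp.gauge`). [cite: Balaban1989LargeFieldI, p.196] -/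
theorem hol_eq_one_of_bondsOneAlong :
    ∀ {p : Site d} {w : List (Letter d)}, BondsOneAlong V p w → hol V p w = 1
  | _, [], _ => rfl
  | p, l :: w, h => by
    obtain ⟨hl, h'⟩ := bondsOneAlong_cons.mp h
    rw [hol_cons, hl, one_mul, hol_eq_one_of_bondsOneAlong h']

/-- One bond of `V″ = V′V₀` ((1.81) [IV], the tree's `mulCfg`) on which `V′ = 1` is the bond of `V₀` (either
orientation). [cite: Balaban1989LargeFieldI, (1.81) p.195] -/
theorem stepHol_mulCfg_of_eq_one {x : Site d} {l : Letter d} (h : stepHol V' x l = 1) :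
    stepHol (mulCfg V' V₀) x l = stepHol V₀ x l := by
  obtain ⟨κ, b⟩ := l
  cases b
  · have h' : V' (x - e κ) κ = 1 := inv_eq_one.mp (by rwa [stepHol_false] at h)
    simp only [stepHol_false, mulCfg, h', one_mul]
  · rw [stepHol_true] at h
    simp only [stepHol_true, mulCfg, h, one_mul]

/-- **p. 381: "The gauge transformation v is determined by V₀ only, because V′ satisfies the conditions"** — along a
contour on whose bonds `V′ = 1`, the parallel transport of `V″ = V′V₀` is that of `V₀`: `V″(Γ) = V₀(Γ)`, so
`v(x) = V″(Γ_{y,x}) = V₀(Γ_{y,x})`. [cite: Balaban1989LargeFieldII, p.381] -/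
theorem hol_mulCfg_eq_of_bondsOneAlong :
    ∀ {p : Site d} {w : List (Letter d)}, BondsOneAlong V' p w → hol (mulCfg V' V₀) p w = hol V₀ p w
  | _, [], _ => rfl
  | p, l :: w, h => by
    obtain ⟨hl, h'⟩ := bondsOneAlong_cons.mp h
    rw [hol_cons, hol_cons, stepHol_mulCfg_of_eq_one hl, hol_mulCfg_eq_of_bondsOneAlong h']

/-- `V″` unitary when `V′`, `V₀` are (`U1`-valued). [cite: Balaban1989LargeFieldI, (1.81) p.195] -/
theorem mulCfg_mem {𝔸 : Type*} [NormedRing 𝔸] [NormOneClass 𝔸] {V' V₀ : Site d → Fin d → 𝔸ˣ}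
    (hV' : ∀ x κ, V' x κ ∈ U1 𝔸) (hV₀ : ∀ x κ, V₀ x κ ∈ U1 𝔸) (x : Site d) (κ : Fin d) :
    mulCfg V' V₀ x κ ∈ U1 𝔸 :=
  (U1 𝔸).mul_mem (hV' x κ) (hV₀ x κ)

end TreeBonds

/-! ## §7 p. 382: "|v(x) − 1| = |V₀(Γ_{y,x}) − 1| < (d + 1)100MR_{j−N+1}·[sup |V₀(b) − 1|]" — telescoping along a walk -/

section BondEstimates

variable {𝔸 : Type*} [NormedRing 𝔸] [NormOneClass 𝔸]

/-- p. 382: *"The estimate holds for b ⊂ Ω″^{~2}_{h+1}∖Ω″_{h+1}, and on this domain … |V₀(b) − 1| ≦ … < O(1)B₃²B₅M⁶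
L^{−N}ε_j"* — the bond hypothesis LOCALIZED to a set `A` of sites: every bond `⟨x, x + e_μ⟩` with both ends in `A` has
`‖V(b) − 1‖ ≤ η`. [cite: Balaban1989LargeFieldII, p.382] -/
def BondSmallOn (A : Set (Site d)) (V : Site d → Fin d → 𝔸ˣ) (η : ℝ) : Prop :=
  ∀ (x : Site d) (μ : Fin d), x ∈ A → x + e μ ∈ A → ‖((V x μ : 𝔸ˣ) : 𝔸) - 1‖ ≤ η

variable {A : Set (Site d)} {V : Site d → Fin d → 𝔸ˣ} {η : ℝ}

/-- One step of a walk in `A` (forward: the bond itself; backward: its inverse, `‖V(b)⁻¹ − 1‖ ≤ ‖V(b) − 1‖` for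
`V(b) ∈ U1`) deviates from `1` by at most `η`. [cite: Balaban1989LargeFieldII, p.382] -/
theorem norm_stepHol_sub_one_le (hV : ∀ x κ, V x κ ∈ U1 𝔸) (hB : BondSmallOn A V η) (x : Site d) (l : Letter d)
    (h1 : x ∈ A) (h2 : x + l.vec ∈ A) : ‖((stepHol V x l : 𝔸ˣ) : 𝔸) - 1‖ ≤ η := by
  obtain ⟨κ, b⟩ := l
  cases b
  · rw [stepHol_false]
    rw [Letter.vec_false, ← sub_eq_add_neg] at h2
    exact (norm_inv_sub_one_le (hV _ _)).trans (hB _ κ h2 (by rw [sub_add_cancel]; exact h1))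
  · rw [stepHol_true]
    rw [Letter.vec_true] at h2
    exact hB x κ h1 h2

/-- **Telescoping along a walk**: for a `U1`-valued field with `η`-small bonds on `A` and a word `w` all of whose
vertices are in `A`, `‖V(w) − 1‖ ≤ |w|·η` — the step *"|v(x) − 1| = |V₀(Γ_{y,x}) − 1| < (length of Γ_{y,x})·[sup_b
|V₀(b) − 1|]"* of p. 382. [cite: Balaban1989LargeFieldII, p.382] -/
theorem norm_hol_sub_one_le_of_pathIn (hV : ∀ x κ, V x κ ∈ U1 𝔸) (hB : BondSmallOn A V η) :
    ∀ (p : Site d) (w : List (Letter d)), PathIn A p w → ‖((hol V p w : 𝔸ˣ) : 𝔸) - 1‖ ≤ w.length * η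
  | p, [], _ => by simp
  | p, l :: w, h => by
    obtain ⟨hp, hw⟩ := pathIn_cons.mp h
    rw [hol_cons, List.length_cons, Nat.cast_succ, add_mul, one_mul]
    calc _ ≤ ‖((stepHol V p l : 𝔸ˣ) : 𝔸) - 1‖ + ‖((hol V (p + l.vec) w : 𝔸ˣ) : 𝔸) - 1‖ :=
          norm_units_mul_sub_one_le (stepHol_mem hV p l)
      _ ≤ η + w.length * η :=
          add_le_add (norm_stepHol_sub_one_le hV hB p l hp hw.start) (norm_hol_sub_one_le_of_pathIn hV hB _ w hw)
      _ = w.length * η + η := add_comm _ _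

/-- **The length of a contour**: for `x ∈ P₁` with sides of at most `W + 1` sites, `|Γ_{y,x}| ≤ (d + 1)·W` (`d = n + 3`;
the usual contour has `d` straight pieces, the detour `d + 1`: *"(d + 1)100MR_{j−N+1}"* on p. 382).
[cite: Balaban1989LargeFieldII, p.382] -/
theorem length_contour_le {n : ℕ} {lo hi : Site (n + 3)} {τ : ℤ} {W : ℕ} (hW : ∀ κ, hi κ - lo κ ≤ W)
    {x : Site (n + 3)} (hx : x ∈ box lo hi) : (contour lo hi τ x).length ≤ (n + 4) * W := by
  have hxb := mem_box_iff.mp hx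
  have hnat : ∀ κ, ((x - lo) κ).natAbs ≤ W := fun κ => by
    have h1 := (hxb κ).1; have h2 := (hxb κ).2; have h3 := hW κ
    simp only [Pi.sub_apply]; omega
  by_cases hxτ : x i0 ≤ τ
  · rw [contour_of_le hxτ, treeWord_eq_tw]
    refine (length_tw_le fun κ _ => hnat κ).trans ?_
    rw [List.length_reverse, List.length_finRange]
    exact Nat.mul_le_mul_right _ (by omega)
  · rw [contour_of_not_le hxτ, List.length_append]
    have h1 : (tw (highDirs n) (x - lo)).length ≤ (n + 1) * W := by
      refine (length_tw_le fun κ _ => hnat κ).trans ?_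
      rw [length_highDirs]
    have h2 : (detourTail lo hi x).length ≤ 3 * W := by
      have h1 := (hxb i0).1; have h2 := (hxb i0).2; have h3 := hW i0
      have h4 := (hxb i1).1; have h5 := (hxb i1).2; have h6 := hW i1
      simp only [detourTail, List.length_append, length_seg]; omega
    have h3 : (n + 4) * W = (n + 1) * W + 3 * W := by ring
    omega

end BondEstimates

/-! ## §8 pp. 381–382: the chain from `V₁` back to `V′` -/

section Fluct

variable {n : ℕ} {𝔸 : Type*} [NormedRing 𝔸] [NormOneClass 𝔸]

/-- **The situation of p. 381, case 1, in the variables of (1.81) [IV] `V″ = V′V₀`** on the annulus `P₁ ∖ P₂ = ann lo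
hi lo' hi'` of `ℤ^{n+3}`: the geometry of [IV] p. 196 (`Geom`), sides of `P₁` of at most `W + 1` sites (condition (i)
of [IV] p. 177), `U1`-valued `V′`, `V₀`; `V′` *"satisfies the conditions"* of the tree gauge of [IV] p. 196 (its bond
variables are `1` along every `Γ_{y,x}`, `x ∈ P₁∖P₂`); *"|V″(∂p′) − 1| < ε for p′ ⊂ Ω″^{~2}_{h+1}∖Ω″_{h+1}"* (plaquettes
of `V″ = V′V₀` with corners in `P₁∖P₂`, `≤ ε`); and the p. 382 input *"|V₀(b) − 1| ≦ … "* `≤ η` on the bonds of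
`P₁∖P₂`. [cite: Balaban1989LargeFieldII, p.381] -/
structure FluctHyp (lo hi lo' hi' : Site (n + 3)) (τ : ℤ) (W : ℕ) (V' V₀ : Site (n + 3) → Fin (n + 3) → 𝔸ˣ)
    (ε η : ℝ) : Prop where
  geom : Geom lo hi lo' hi' τ
  width : ∀ κ, hi κ - lo κ ≤ W
  unit' : ∀ x κ, V' x κ ∈ U1 𝔸
  unit₀ : ∀ x κ, V₀ x κ ∈ U1 𝔸
  eps_nonneg : 0 ≤ ε
  eta_nonneg : 0 ≤ η
  tree : ∀ x ∈ ann lo hi lo' hi', BondsOneAlong V' lo (contour lo hi τ x)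
  plaq : PlaqSmallOn (ann lo hi lo' hi') (mulCfg V' V₀) ε
  bond₀ : BondSmallOn (ann lo hi lo' hi') V₀ η

variable {lo hi lo' hi' : Site (n + 3)} {τ : ℤ} {W : ℕ} {V' V₀ : Site (n + 3) → Fin (n + 3) → 𝔸ˣ} {ε η : ℝ}

/-- `V′` satisfies the contour conditions `V′(Γ_{y,x}) = 1`, `x ∈ P₁∖P₂` (the [14] p. 79 form of the gauge).
[cite: Balaban1989LargeFieldI, p.196] -/
theorem FluctHyp.hol_contour (H : FluctHyp lo hi lo' hi' τ W V' V₀ ε η) {x : Site (n + 3)}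
    (hx : x ∈ ann lo hi lo' hi') : hol V' lo (contour lo hi τ x) = 1 :=
  hol_eq_one_of_bondsOneAlong (H.tree x hx)

/-- **p. 381: "v is determined by V₀ only, because V′ satisfies the conditions, and is given by v(x) = V₀(Γ_{y,x})"** —
on `P₁∖P₂` the gauge function built from `V″ = V′V₀` (PART 2's `treeGaugeFn V″`) IS the one built from `V₀`.
[cite: Balaban1989LargeFieldII, p.381] -/
theorem FluctHyp.treeGaugeFn_mulCfg (H : FluctHyp lo hi lo' hi' τ W V' V₀ ε η) {x : Site (n + 3)}
    (hx : x ∈ ann lo hi lo' hi') : treeGaugeFn (mulCfg V' V₀) lo hi τ x = treeGaugeFn V₀ lo hi τ x :=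
  hol_mulCfg_eq_of_bondsOneAlong (H.tree x hx)

/-- Consequently the two gauge-fixed fields `V″^v` — `v` from `V″` (PART 2, `case1Hyp_gaugeFixed`) or `v` from `V₀`
(p. 381) — have the same bond variables on the bonds of `P₁∖P₂`. [cite: Balaban1989LargeFieldII, p.381] -/
theorem FluctHyp.gaugeAct_treeGaugeFn_eq (H : FluctHyp lo hi lo' hi' τ W V' V₀ ε η) {x : Site (n + 3)}
    {μ : Fin (n + 3)} (hx : x ∈ ann lo hi lo' hi') (hx' : x + e μ ∈ ann lo hi lo' hi') :
    gaugeAct (treeGaugeFn (mulCfg V' V₀) lo hi τ) (mulCfg V' V₀) x μ =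
      gaugeAct (treeGaugeFn V₀ lo hi τ) (mulCfg V' V₀) x μ := by
  rw [gaugeAct, gaugeAct, H.treeGaugeFn_mulCfg hx, H.treeGaugeFn_mulCfg hx']

/-- **p. 381: "We obtain the field V₁ = V″^v = v₋V′V₀v₊⁻¹, which satisfies … the axial gauge conditions"** — with the
printed `v(x) = V₀(Γ_{y,x})`, the field `V₁` satisfies the hypotheses `Case1Hyp` of PART 2 (its plaquettes on `P₁∖P₂`
are conjugates of those of `V″`, and `V₁(Γ_{y,x}) = v(y)V″(Γ_{y,x})v(x)⁻¹ = V₀(Γ_{y,x})V₀(Γ_{y,x})⁻¹ = 1`).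
[cite: Balaban1989LargeFieldII, p.381] -/
theorem FluctHyp.case1Hyp (H : FluctHyp lo hi lo' hi' τ W V' V₀ ε η) :
    Case1Hyp lo hi lo' hi' τ W (gaugeAct (treeGaugeFn V₀ lo hi τ) (mulCfg V' V₀)) ε where
  geom := H.geom
  width := H.width
  unit := gaugeAct_mem (mulCfg_mem H.unit' H.unit₀) fun _ => hol_mem H.unit₀ _ _
  eps_nonneg := H.eps_nonneg
  plaq := H.plaq.gaugeAct fun _ => hol_mem H.unit₀ _ _
  gauge := fun x hx => by
    rw [hol_gaugeAct, disp_contour, add_sub_cancel, hol_mulCfg_eq_of_bondsOneAlong (H.tree x hx), treeGaugeFn,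
      treeGaugeFn, contour_self H.geom.lo_le_tau, hol_nil, one_mul, mul_inv_cancel]

/-- **p. 382 l. 1–2 for the printed `V₁`**: every bond `b` with both ends in `P₁∖P₂` has `‖V₁(b) − 1‖ ≤ (5W² + dW)ε`
(PART 2's `norm_bond_sub_one_le` for `V₁ = V″^v`, `v(x) = V₀(Γ_{y,x})`). [cite: Balaban1989LargeFieldII, p.382] -/
theorem FluctHyp.norm_V₁_sub_one_le (H : FluctHyp lo hi lo' hi' τ W V' V₀ ε η) {x : Site (n + 3)}
    {μ : Fin (n + 3)} (hx : x ∈ ann lo hi lo' hi') (hx' : x + e μ ∈ ann lo hi lo' hi') :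
    ‖((gaugeAct (treeGaugeFn V₀ lo hi τ) (mulCfg V' V₀) x μ : 𝔸ˣ) : 𝔸) - 1‖ ≤
      (5 * (W : ℝ) ^ 2 + (n + 3) * W) * ε :=
  norm_bond_sub_one_le H.case1Hyp hx hx'

/-- **p. 382, first display, for the printed `V₁`**: *"|V₁(b) − 1| < 6(100MR_{j−N+1})²ε"* — the row's typed shape
`B16Sect1Statements.Ineq382V₁` for `V₁ = V″^v` with `v(x) = V₀(Γ_{y,x})` (sides of `≤ 100MR′` sites, `d ≤ 100MR′`).
[cite: Balaban1989LargeFieldII, p.382] -/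
theorem FluctHyp.ineq382V₁ (H : FluctHyp lo hi lo' hi' τ W V' V₀ ε η) {M R' : ℕ} (hD : W + 1 ≤ 100 * M * R')
    (hd : n + 3 ≤ 100 * M * R') (hε : 0 < ε) {x : Site (n + 3)} {μ : Fin (n + 3)} (hx : x ∈ ann lo hi lo' hi')
    (hx' : x + e μ ∈ ann lo hi lo' hi') :
    B16Sect1Statements.Ineq382V₁ ‖((gaugeAct (treeGaugeFn V₀ lo hi τ) (mulCfg V' V₀) x μ : 𝔸ˣ) : 𝔸) - 1‖ M R' ε :=
  _root_.Literature.MathematicalPhysics.QuantumFieldTheory.Balaban1983to89.B16Ineq382.ineq382V₁ H.case1Hyp hD hd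
    hε hx hx'

/-- **p. 382: "hence |v(x) − 1| = |V₀(Γ_{y,x}) − 1| < (d + 1)100MR_{j−N+1}·[sup |V₀(b) − 1|]"** — for `x ∈ P₁∖P₂`,
`‖v(x) − 1‖ ≤ (d + 1)W·η`: the contour stays in `P₁∖P₂` (`contour_pathIn`), has `≤ (d + 1)W` bonds, and each of its
bonds deviates by `≤ η`. [cite: Balaban1989LargeFieldII, p.382] -/
theorem FluctHyp.norm_treeGaugeFn_sub_one_le (H : FluctHyp lo hi lo' hi' τ W V' V₀ ε η) {x : Site (n + 3)}
    (hx : x ∈ ann lo hi lo' hi') : ‖((treeGaugeFn V₀ lo hi τ x : 𝔸ˣ) : 𝔸) - 1‖ ≤ (n + 4) * W * η := by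
  have h1 := norm_hol_sub_one_le_of_pathIn H.unit₀ H.bond₀ lo (contour lo hi τ x) (contour_pathIn H.geom hx)
  have h2 : ((contour lo hi τ x).length : ℝ) ≤ (n + 4) * W := by
    exact_mod_cast length_contour_le (τ := τ) H.width hx.1
  exact h1.trans (mul_le_mul_of_nonneg_right h2 H.eta_nonneg)

/-- **p. 381: `V₁ = v₋V′V₀v₊⁻¹` solved for the fluctuation field**: `V′(b) = v₋⁻¹ · V₁(b) · v₊ · V₀(b)⁻¹`.
[cite: Balaban1989LargeFieldII, p.381] -/
theorem fluct_eq {G : Type*} [Group G] (v : Site (n + 3) → G) (V' V₀ : Site (n + 3) → Fin (n + 3) → G)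
    (x : Site (n + 3)) (μ : Fin (n + 3)) :
    V' x μ = (v x)⁻¹ * gaugeAct v (mulCfg V' V₀) x μ * v (x + e μ) * (V₀ x μ)⁻¹ := by
  simp only [gaugeAct, mulCfg]
  group

/-- **p. 382: "From the above estimates we obtain |V′(b) − 1| < …", object level**: for every bond `b = ⟨x, x + e_μ⟩`
with both ends in `P₁∖P₂`, `‖V′(b) − 1‖ ≤ ‖V₁(b) − 1‖ + ‖v(b₋) − 1‖ + ‖v(b₊) − 1‖ + ‖V₀(b) − 1‖ ≤ (5W² + dW)ε + (2(d +
1)W + 1)η` (`W + 1` = sites per side of `P₁`, `d = n + 3`). [cite: Balaban1989LargeFieldII, p.382] -/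
theorem FluctHyp.norm_fluct_sub_one_le (H : FluctHyp lo hi lo' hi' τ W V' V₀ ε η) {x : Site (n + 3)}
    {μ : Fin (n + 3)} (hx : x ∈ ann lo hi lo' hi') (hx' : x + e μ ∈ ann lo hi lo' hi') :
    ‖((V' x μ : 𝔸ˣ) : 𝔸) - 1‖ ≤ (5 * (W : ℝ) ^ 2 + (n + 3) * W) * ε + (2 * ((n + 4) * W) + 1) * η := by
  have hv : ∀ z, treeGaugeFn V₀ lo hi τ z ∈ U1 𝔸 := fun z => hol_mem H.unit₀ _ _
  have hV₁ := H.norm_V₁_sub_one_le hx hx'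
  have hV₁u : gaugeAct (treeGaugeFn V₀ lo hi τ) (mulCfg V' V₀) x μ ∈ U1 𝔸 := H.case1Hyp.unit x μ
  have hvm := H.norm_treeGaugeFn_sub_one_le hx
  have hvp := H.norm_treeGaugeFn_sub_one_le hx'
  have hV0 : ‖((V₀ x μ : 𝔸ˣ) : 𝔸) - 1‖ ≤ η := H.bond₀ x μ hx hx'
  have ha : (treeGaugeFn V₀ lo hi τ x)⁻¹ ∈ U1 𝔸 := (U1 𝔸).inv_mem (hv x)
  have hab : (treeGaugeFn V₀ lo hi τ x)⁻¹ * gaugeAct (treeGaugeFn V₀ lo hi τ) (mulCfg V' V₀) x μ ∈ U1 𝔸 :=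
    (U1 𝔸).mul_mem ha hV₁u
  have habc : (treeGaugeFn V₀ lo hi τ x)⁻¹ * gaugeAct (treeGaugeFn V₀ lo hi τ) (mulCfg V' V₀) x μ *
      treeGaugeFn V₀ lo hi τ (x + e μ) ∈ U1 𝔸 := (U1 𝔸).mul_mem hab (hv _)
  have e1 := norm_units_mul_sub_one_le (q := (V₀ x μ)⁻¹) habc
  have e2 := norm_units_mul_sub_one_le (q := treeGaugeFn V₀ lo hi τ (x + e μ)) hab
  have e3 := norm_units_mul_sub_one_le (q := gaugeAct (treeGaugeFn V₀ lo hi τ) (mulCfg V' V₀) x μ) ha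
  have e4 := norm_inv_sub_one_le (hv x)
  have e5 := norm_inv_sub_one_le (H.unit₀ x μ)
  rw [fluct_eq (treeGaugeFn V₀ lo hi τ) V' V₀ x μ]
  linarith

/-- **p. 382, printed strict shape**: with `D ≥ W + 1` (sites per side: condition (i) of [IV], `D = 100MR_{j−N+1}`),
`d ≤ D` and `0 < ε`, `‖V′(b) − 1‖ < 6D²ε + (2(d + 1)D + 1)η` — the first display's `6(100MR_{j−N+1})²ε` plus two
factors `v` of `(d + 1)100MR_{j−N+1}·η` and one bond of `V₀`. [cite: Balaban1989LargeFieldII, p.382] -/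
theorem FluctHyp.norm_fluct_sub_one_lt (H : FluctHyp lo hi lo' hi' τ W V' V₀ ε η) {D : ℝ} (hD : (W : ℝ) + 1 ≤ D)
    (hd : (n : ℝ) + 3 ≤ D) (hε : 0 < ε) {x : Site (n + 3)} {μ : Fin (n + 3)} (hx : x ∈ ann lo hi lo' hi')
    (hx' : x + e μ ∈ ann lo hi lo' hi') :
    ‖((V' x μ : 𝔸ˣ) : 𝔸) - 1‖ < 6 * D ^ 2 * ε + (2 * ((n : ℝ) + 4) * D + 1) * η := by
  have hle := H.norm_fluct_sub_one_le hx hx'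
  have hW : (0 : ℝ) ≤ W := Nat.cast_nonneg W
  have hn : (0 : ℝ) ≤ n := Nat.cast_nonneg n
  have hD0 : (0 : ℝ) ≤ D := by linarith
  have h1 : ((W : ℝ) + 1) * ((W : ℝ) + 1) ≤ D * D := mul_le_mul hD hD (by positivity) hD0
  have h2 : ((n : ℝ) + 3) * ((W : ℝ) + 1) ≤ D * D := mul_le_mul hd hD (by positivity) hD0
  have hA : 5 * (W : ℝ) ^ 2 + (n + 3) * W < 6 * D ^ 2 := by nlinarith
  have hA' : (5 * (W : ℝ) ^ 2 + (n + 3) * W) * ε < 6 * D ^ 2 * ε := mul_lt_mul_of_pos_right hA hε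
  have hB : (2 * (((n : ℝ) + 4) * W) + 1) * η ≤ (2 * ((n : ℝ) + 4) * D + 1) * η := by
    refine mul_le_mul_of_nonneg_right ?_ H.eta_nonneg
    nlinarith
  linarith

end Fluct

/-! ## §9 The dictionary to the row's typed shape `B16Sect1Statements.Ineq382V'` -/

section Dictionary

/-- **The arithmetic of the last two displays of case 1** (pure real arithmetic): from `dev < 6(100MR′)²ε + (2k·100MR′
+ 1)η` and the printed inputs — sides `100MR′ ≥ 1`, `R′ ≤ (L + 1)R_j^{1+β₀}`, `η ≤ K·B₃²B₅M⁶(L⁻¹)^N ε_j` (the (1.87)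
[IV] bound on `V₀`), `ε_j = (A₀/A₁)(p₀(g_j)/p₁(g_j))δ′_j` — the typed `Ineq382V' dev M L R_j β₀ ε C …` with `C = 100(2k
+ 1)(L + 1)K`: *"|V′(b) − 1| < 6(100M(L + 1)R_j^{1+β₀})²ε + O(1)(A₀/A₁)B₃²B₅M⁷R_j^{1+β₀}(p₀(g_j)/p₁(g_j))L^{−N}δ′_j"*.
[cite: Balaban1989LargeFieldII, p.382] -/
theorem ineq382V'_of_bound {dev M R' L Rj β₀ ε η k K A₀ A₁ B₃ B₅ p₀g p₁g Linv εj δ'j : ℝ} {N : ℕ}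
    (hdev : dev < 6 * (100 * M * R') ^ 2 * ε + (2 * k * (100 * M * R') + 1) * η) (hk : 0 ≤ k) (hM : 0 ≤ M)
    (hD1 : 1 ≤ 100 * M * R') (hRj : R' ≤ (L + 1) * Rj ^ (1 + β₀)) (hε : 0 ≤ ε) (hη0 : 0 ≤ η)
    (hη : η ≤ K * B₃ ^ 2 * B₅ * M ^ 6 * Linv ^ N * εj) (hεj : εj = A₀ / A₁ * (p₀g / p₁g) * δ'j) :
    B16Sect1Statements.Ineq382V' dev M L Rj β₀ ε (100 * (2 * k + 1) * (L + 1) * K) A₀ A₁ B₃ B₅ p₀g p₁g Linv N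
      δ'j := by
  unfold B16Sect1Statements.Ineq382V'
  set D := 100 * M * R' with hD
  set S := K * B₃ ^ 2 * B₅ * M ^ 6 * Linv ^ N * εj with hS
  have hD0 : 0 ≤ D := by linarith
  have hS0 : 0 ≤ S := hη0.trans hη
  have hDle : D ≤ 100 * M * (L + 1) * Rj ^ (1 + β₀) := by
    have := mul_le_mul_of_nonneg_left hRj (by linarith : (0 : ℝ) ≤ 100 * M)
    rw [hD]
    linarith
  have h1 : 6 * D ^ 2 * ε ≤ 6 * (100 * M * (L + 1) * Rj ^ (1 + β₀)) ^ 2 * ε :=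
    mul_le_mul_of_nonneg_right (mul_le_mul_of_nonneg_left (pow_le_pow_left₀ hD0 hDle 2) (by norm_num)) hε
  have h2 : (2 * k * D + 1) * η ≤ (2 * k + 1) * D * S := by
    calc (2 * k * D + 1) * η ≤ (2 * k + 1) * D * η := by
          refine mul_le_mul_of_nonneg_right ?_ hη0
          nlinarith
      _ ≤ (2 * k + 1) * D * S := mul_le_mul_of_nonneg_left hη (mul_nonneg (by linarith) hD0)
  have h3 : (2 * k + 1) * D * S ≤ (2 * k + 1) * (100 * M * (L + 1) * Rj ^ (1 + β₀)) * S :=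
    mul_le_mul_of_nonneg_right (mul_le_mul_of_nonneg_left hDle (by linarith)) hS0
  have h4 : (2 * k + 1) * (100 * M * (L + 1) * Rj ^ (1 + β₀)) * S =
      100 * (2 * k + 1) * (L + 1) * K * (A₀ / A₁) * B₃ ^ 2 * B₅ * M ^ 7 * Rj ^ (1 + β₀) * (p₀g / p₁g) *
        Linv ^ N * δ'j := by
    rw [hS, hεj]; ring
  linarith

variable {n : ℕ} {𝔸 : Type*} [NormedRing 𝔸] [NormOneClass 𝔸]
variable {lo hi lo' hi' : Site (n + 3)} {τ : ℤ} {W : ℕ} {V' V₀ : Site (n + 3) → Fin (n + 3) → 𝔸ˣ} {ε η : ℝ}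

/-- **The row's typed shape for `V′(b)`, discharged by name**: in the situation `FluctHyp` (p. 381, case 1, variables
`V′, V₀`), with sides of `≤ 100MR′` sites and `d ≤ 100MR′` (condition (i) of [IV]), `R′ ≤ (L + 1)R_j^{1+β₀}`, `0 < ε`,
the `V₀` input `η ≤ K·B₃²B₅M⁶(L⁻¹)^N ε_j` and `ε_j = (A₀/A₁)(p₀/p₁)δ′_j`, every bond `b` with both ends in `P₁∖P₂`
satisfies `B16Sect1Statements.Ineq382V' ‖V′(b) − 1‖ M L R_j β₀ ε C A₀ A₁ B₃ B₅ p₀(g_j) p₁(g_j) L⁻¹ N δ′_j` with the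
explicit `C = 100(2d + 3)(L + 1)K` (`d = n + 3`). [cite: Balaban1989LargeFieldII, p.382] -/
theorem FluctHyp.ineq382V' (H : FluctHyp lo hi lo' hi' τ W V' V₀ ε η)
    {M R' L Rj β₀ K A₀ A₁ B₃ B₅ p₀g p₁g Linv εj δ'j : ℝ} {N : ℕ} (hD : (W : ℝ) + 1 ≤ 100 * M * R')
    (hd : (n : ℝ) + 3 ≤ 100 * M * R') (hM : 0 ≤ M) (hRj : R' ≤ (L + 1) * Rj ^ (1 + β₀)) (hε : 0 < ε)
    (hη : η ≤ K * B₃ ^ 2 * B₅ * M ^ 6 * Linv ^ N * εj) (hεj : εj = A₀ / A₁ * (p₀g / p₁g) * δ'j)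
    {x : Site (n + 3)} {μ : Fin (n + 3)} (hx : x ∈ ann lo hi lo' hi') (hx' : x + e μ ∈ ann lo hi lo' hi') :
    B16Sect1Statements.Ineq382V' ‖((V' x μ : 𝔸ˣ) : 𝔸) - 1‖ M L Rj β₀ ε
      (100 * (2 * ((n : ℝ) + 4) + 1) * (L + 1) * K) A₀ A₁ B₃ B₅ p₀g p₁g Linv N δ'j := by
  have hW : (0 : ℝ) ≤ W := Nat.cast_nonneg W
  exact ineq382V'_of_bound (H.norm_fluct_sub_one_lt hD hd hε hx hx') (by positivity) hM (by linarith) hRj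
    hε.le H.eta_nonneg hη hεj

end Dictionary

end Literature.MathematicalPhysics.QuantumFieldTheory.Balaban1983to89.B16Ineq382
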